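import Mathlib
import Summits.ValiantsHypothesis.ValiantsHypothesis.Theses.TwoAdicLadder

/-!
# Birth skeleton (BC3) for crux `TwoAdicLadder.PrecisionLadder`
# (stmt-ValiantsHypothesis-5948, route-ValiantsHypothesis-TwoAdicLadder; skeleton-register, gen 1)

Crux decl `Summit.ValiantsHypothesis.ValiantsHypothesis.Theses.TwoAdicLadder.PrecisionLadder`
(rank 3, the hardness half of the route thesis):

  `∀ c, ∃ᶠ n in atTop, ∃ k, ∀ R` finite commutative principal ideal ring with `2` nilpotent and
  `2 ^ k ≠ 0` (= ADMISSIBLE AT PRECISION `k`), `n ^ c < L_R(per_n)`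

("the exponent of the permanent modulo `2^k` is unbounded in `k`", uniformly over all finite chain
rings of 2-adic precision `> k`, any residue degree and ramification).

## The line: the route's own foreseen split `PrecisionLadder ⇐ LadderZ + Descent`, with the
## structure-theory step cut out as a provable stub

The route header (TWO-LAYER PLAN) foresees
`PrecisionLadder ⇐ LadderZ → Descent → PrecisionLadder`, "LadderZ the same statement over the prime
rings ℤ/2^k only … and Descent: L_{ℤ/2^k}(per_n) ≤ poly(n)·L_R(per_n) for every R admissible at
precision k (constants of big chain rings do not help superpolynomially; residue-degree part = the
𝔽̄₂-vs-𝔽₂ question, ramification part new)".  This skeleton types exactly that split, in EXPONENT form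
(so that the composition is pure filter logic, no arithmetic of polynomial overheads), and separates
from Descent the purely structural reduction "admissible ring ↦ one finite chain ring of
characteristic exactly `2^(k+1)`", which is provable now from Mathlib's Artinian structure theory:

* `stub_ladderZ` (OPEN, hardest): `∀ c, ∃ᶠ n, ∃ k, n ^ c < L_{ℤ/2^(k+1)}(per_n)` — the ladder over the
  PRIME rings `ZMod (2^(k+1))` only (the smallest ring admissible at precision `k`).  It is a
  CONSEQUENCE of the crux (instantiate `R := ZMod (2^(k+1))`) and itself implies the negative answer to
  Koiran's question "is τ(per_n) polynomially bounded?" (arXiv:1004.4960 §1): a constant-free ℤ-circuit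
  reduces mod `2^(k+1)` at no cost (tree `complexity_map_le_constantFreeComplexity`), so
  `stub_ladderZ ⇒ τ(per_n) ≠ n^{O(1)}`; like the crux it is implied by VH (the ultraproduct argument of
  support `LadderOfVH` run over `∏_k ℤ/2^(k+1)`: a prime avoiding the powers of `2` has odd integers as
  units, so the quotient domain has characteristic `0`).
  Every rung `c ≥ 3` is an explicit superlinear circuit lower bound over a FIXED finite ring, beyond
  Baur–Strassen `Ω(N log d)`; rung `k = 0` (`𝔽₂`, per = det, Berkowitz) is useless but harmless (`∃ k`).
* `stub_localise` (PROVABLE NOW, size M): every ring `R` admissible at precision `k` maps onto a finite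
  LOCAL principal ideal ring `S` (= finite chain ring) of characteristic exactly `2^(k+1)` with
  `L_S(per_n) ≤ L_R(per_n)`.  Proof sketch for the prover: `R` finite ⇒ Artinian ⇒
  `R ≃ ∏_𝔪 R ⧸ 𝔪^N` (Mathlib `IsArtinianRing.quotNilradicalPowEquivPi` with `nilradical R ^ N = 0`);
  `2^k ≠ 0` survives in some factor `R ⧸ 𝔪^N`; pass to `S := (R ⧸ 𝔪^N) ⧸ (2^(k+1))`, where still
  `2^k ≠ 0` (if `2^k = 2^(k+1)·r` then `2^k·(1 - 2r) = 0` with `1 - 2r` a unit), so `CharP S (2^(k+1))`;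
  `S` is local (quotient of a local ring by a proper ideal), principal
  (`IsPrincipalIdealRing.of_surjective`), finite; and `L_S(per_n) ≤ L_R(per_n)` by pushing a circuit
  along `R →+* S` (tree `ArithCircuit.complexity_map_le`, `map_perPoly`).
* `stub_descent` (OPEN): DESCENT WITH POLYNOMIAL OVERHEAD, uniformly in the precision: for every `c`
  there is `c'` such that for all large `n`, every `k` and every finite chain ring `S` of
  characteristic `2^(k+1)`: `L_S(per_n) ≤ n^c ⇒ L_{ℤ/2^(k+1)}(per_n) ≤ n^{c'}`.  A finite chain ring of
  characteristic `2^(k+1)` is `GR(2^(k+1), f)[x]/(g, 2^k x^t)` (`g` Eisenstein of degree `e`; the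
  classical structure theorem for finite chain rings, Clark–Liang 1973 / McDonald 1974 Ch. XVII);
  simulating its arithmetic over the prime subring
  `ℤ/2^(k+1)` by structure constants costs a factor `O(e² f²)`, so the stub says: residue degree `f`
  and ramification `e` SUPERPOLYNOMIAL in `n` do not help the permanent superpolynomially ("big
  constants do not help").  For `k = 0` (`S` of characteristic 2, per = det) the conclusion holds
  outright by Berkowitz (tree `isVPFamily_detPoly_of_commRing`), so the content is `k ≥ 1`, uniform in
  `k`.  Why it might fail: no descent with overhead polynomial in `log f` is known even over FIELDS
  (`L_{𝔽₂}` versus `L_{𝔽_{2^f}}` for polynomials over `𝔽₂` — the non-closed-field case left open by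
  Bürgisser 2000 §4.1, whose field independence is for algebraically closed fields only); constants of
  residue degree `f(n) = n^{ω(1)}` could in principle encode `per_n`-specific data.

Neither open stub is comparable to the crux or to the summit by a cheap implication:
`stub_ladderZ → PrecisionLadder` IS the descent problem, `stub_descent → PrecisionLadder` would be a
lower bound from an upper-bound transfer, `stub_localise` is structure theory; BC3 probes
(`stub → PrecisionLadder`, `stub → ValiantsHypothesis` by `first | exact? | simpa | aesop`) FAIL for all
three — registrar's NOTES.md.

COMPOSITION `PrecisionLadder_of : Stmt.stub_ladderZ → Stmt.stub_localise → Stmt.stub_descent →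
PrecisionLadder` (kernel-checked, no sorry): given `c`, take `c'` from `stub_descent c`; `stub_ladderZ c'`
gives frequently-in-`n` a precision `k` with `n^{c'} < L_{ℤ/2^(k+1)}(per_n)`, and
`Filter.Frequently.and_eventually` intersects this with the eventually-true descent clause; for that
`n` and that `k`, an admissible `R` with `L_R(per_n) ≤ n^c` would give (`stub_localise`) a chain ring `S`
of characteristic `2^(k+1)` with `L_S(per_n) ≤ n^c`, hence (`stub_descent`) `L_{ℤ/2^(k+1)}(per_n) ≤ n^{c'}`,
contradiction.

## Shape (skeleton audit by-name rule, as in `Cruxes/ContractiveHardness/Lines/birth.lean`)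
* `Stmt.stub_…` — the three stub statements as precise `Prop`s, named like the stubs;
* `stub_…` — the same statements as sorried theorems (the REGISTERED stubs; `sorry` occurs nowhere else);
* `PrecisionLadder_of` — the composition, real proof;
  `PrecisionLadder_proof : PrecisionLadder := PrecisionLadder_of stub_ladderZ stub_localise stub_descent`
  ties the two copies (the compiler checks that the `Stmt` copies and the stub statements agree).
All stubs are DEF-FREE beyond Mathlib (`ZMod`, `IsLocalRing`, `IsPrincipalIdealRing`, `CharP`,
`Filter`) + `Literature.Computability.AlgebraicComplexity.complexity / perPoly`, so each can land as
`Theorems/TwoAdicLadderPrecisionLadder<Stub>.lean` with `--supports stmt-ValiantsHypothesis-5948`.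

**Disproof used.** None exists: `Cruxes/PrecisionLadder/` had no workfiles (no `Disproof.lean`, no
`Negative/` lemma) at registration (2026-08-17); `ledger negatives --problem ValiantsHypothesis` (4 entries:
UlrichPadded, Elusive, GrenetRigidity ×2) has no statement about finite rings, `ZMod (2^k)` or the
complexity of `perPoly` over them — no stub is an instance a landed Negative lemma refutes.
Hardest stub: `stub_ladderZ`.
-/

namespace Summit.ValiantsHypothesis.ValiantsHypothesis.Cruxes.PrecisionLadder.Birth

open Filter
open Literature.Computability.AlgebraicComplexity
open Summit.ValiantsHypothesis.ValiantsHypothesis.Theses.TwoAdicLadder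

set_option linter.dupNamespace false

/-! ## The three stub statements -/

/-- STUB 1 — THE LADDER OVER THE PRIME RINGS `ℤ/2^(k+1)` (open; hardest stub).  For every exponent `c`
there are infinitely many `n` for which SOME precision `k` forces `n ^ c < L_{ZMod (2^(k+1))}(per_n)`:
the exponent of the permanent over the prime rings `ℤ/2^(k+1)` is unbounded in `k`.  A consequence of the
crux (`R := ZMod (2^(k+1))` is admissible at precision `k`); implies `τ(per_n) ≠ n^{O(1)}` (Koiran,
arXiv:1004.4960 §1) since constant-free ℤ-circuits reduce modulo `2^(k+1)` at no cost
(`complexity_map_le_constantFreeComplexity`); implied by VH (ultraproduct over `k`, as in support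
`LadderOfVH`).  Why plausibly true: it follows from VH.  Why it
might fail: only together with VH; as a programme each rung `c ≥ 3` is an explicit superlinear lower
bound over a fixed finite ring (Baur–Strassen gives rung `c < 3` only; rung `k = 0` is `𝔽₂`, per = det).
Size: XL (open). -/
def Stmt.stub_ladderZ : Prop :=
  ∀ c : ℕ, ∃ᶠ n in Filter.atTop, ∃ k : ℕ,
    n ^ c < complexity (perPoly (Fin n) (ZMod (2 ^ (k + 1))))

/-- STUB 2 — LOCALISE TO ONE CHAIN RING OF CHARACTERISTIC `2^(k+1)` (provable now, size M).  Every finite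
commutative principal ideal ring `R` with `2` nilpotent and `2 ^ k ≠ 0` maps onto a finite LOCAL principal
ideal ring `S` (a finite chain ring) of characteristic exactly `2^(k+1)` over which the permanent is no
harder: `L_S(per_n) ≤ L_R(per_n)`.  Proof sketch: Artinian structure theorem
(`IsArtinianRing.quotNilradicalPowEquivPi`, `nilradical R ^ N = 0`) gives `R ≃ ∏_𝔪 R ⧸ 𝔪^N`; `2^k ≠ 0`
in some factor; quotient that factor by `2^(k+1)` (still `2^k ≠ 0`: `2^k = 2^(k+1) r ⇒ 2^k (1 - 2r) = 0`,
`1 - 2r` a unit); local, principal (`IsPrincipalIdealRing.of_surjective`), finite, `CharP _ (2^(k+1))`;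
complexity along `R →+* S` by `ArithCircuit.complexity_map_le` + `map_perPoly`. -/
def Stmt.stub_localise : Prop :=
  ∀ (n k : ℕ) (R : Type) [CommRing R] [Fintype R],
    IsPrincipalIdealRing R → IsNilpotent (2 : R) → (2 : R) ^ k ≠ 0 →
    ∃ (S : Type) (_ : CommRing S) (_ : Fintype S),
      IsLocalRing S ∧ IsPrincipalIdealRing S ∧ CharP S (2 ^ (k + 1)) ∧
      complexity (perPoly (Fin n) S) ≤ complexity (perPoly (Fin n) R)

/-- STUB 3 — DESCENT TO THE PRIME RING WITH POLYNOMIAL OVERHEAD, UNIFORMLY IN THE PRECISION (open).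
For every `c` there is `c'` such that for all large `n`, every precision `k` and every finite chain ring
`S` (finite local principal ideal ring) of characteristic `2^(k+1)`: if `L_S(per_n) ≤ n ^ c` then
`L_{ZMod (2^(k+1))}(per_n) ≤ n ^ c'`.  `S = GR(2^(k+1), f)[x]/(g, 2^k x^t)`, `g` Eisenstein of degree
`e` (structure theorem for finite chain rings, Clark–Liang 1973 / McDonald 1974 Ch. XVII);
structure-constant simulation over the prime subring `ℤ/2^(k+1)` costs `O(e² f²)`, so the claim is that
residue degree `f` and ramification `e` superpolynomial in `n` do not help the permanent
superpolynomially.  Trivially true at `k = 0` (characteristic 2: per = det, Berkowitz,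
`isVPFamily_detPoly_of_commRing`).  Why it might fail: no descent polynomial in `log f` is known even for
fields (`𝔽_{2^f}` vs `𝔽₂` constants; Bürgisser 2000 §4.1 covers algebraically closed fields only).
Size: L–XL (open). -/
def Stmt.stub_descent : Prop :=
  ∀ c : ℕ, ∃ c' : ℕ, ∀ᶠ n in Filter.atTop, ∀ (k : ℕ) (S : Type) [CommRing S] [Fintype S],
    IsLocalRing S → IsPrincipalIdealRing S → CharP S (2 ^ (k + 1)) →
    complexity (perPoly (Fin n) S) ≤ n ^ c →
    complexity (perPoly (Fin n) (ZMod (2 ^ (k + 1)))) ≤ n ^ c'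

/-! ## Registered stubs (the ONLY sorries of this file) -/

/-- Registered stub 1 = `Stmt.stub_ladderZ` (the ladder over the prime rings `ZMod (2^(k+1))`). -/
theorem stub_ladderZ :
    ∀ c : ℕ, ∃ᶠ n in Filter.atTop, ∃ k : ℕ,
      n ^ c < complexity (perPoly (Fin n) (ZMod (2 ^ (k + 1)))) := by
  sorry

/-- Registered stub 2 = `Stmt.stub_localise` (admissible ring ↦ chain ring of characteristic `2^(k+1)`). -/
theorem stub_localise :
    ∀ (n k : ℕ) (R : Type) [CommRing R] [Fintype R],
      IsPrincipalIdealRing R → IsNilpotent (2 : R) → (2 : R) ^ k ≠ 0 →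
      ∃ (S : Type) (_ : CommRing S) (_ : Fintype S),
        IsLocalRing S ∧ IsPrincipalIdealRing S ∧ CharP S (2 ^ (k + 1)) ∧
        complexity (perPoly (Fin n) S) ≤ complexity (perPoly (Fin n) R) := by
  sorry

/-- Registered stub 3 = `Stmt.stub_descent` (descent to `ZMod (2^(k+1))` with polynomial overhead). -/
theorem stub_descent :
    ∀ c : ℕ, ∃ c' : ℕ, ∀ᶠ n in Filter.atTop, ∀ (k : ℕ) (S : Type) [CommRing S] [Fintype S],
      IsLocalRing S → IsPrincipalIdealRing S → CharP S (2 ^ (k + 1)) →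
      complexity (perPoly (Fin n) S) ≤ n ^ c →
      complexity (perPoly (Fin n) (ZMod (2 ^ (k + 1)))) ≤ n ^ c' := by
  sorry

/-! ## The composition (kernel-checked, sorry-free) -/

/-- **The crux from the three stubs** (composition; conclusion literally the route decl).  Given `c`,
`stub_descent c` yields `c'`; `stub_ladderZ c'` holds frequently in `n`, the descent clause eventually, so
(`Frequently.and_eventually`) some arbitrarily large `n` has both; its precision `k` is the witness: an
admissible `R` with `L_R(per_n) ≤ n^c` localises (`stub_localise`) to a chain ring `S` of characteristic
`2^(k+1)` with `L_S(per_n) ≤ n^c`, descends to `L_{ZMod (2^(k+1))}(per_n) ≤ n^{c'}`, contradicting the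
ladder rung. -/
theorem PrecisionLadder_of :
    Stmt.stub_ladderZ → Stmt.stub_localise → Stmt.stub_descent →
      Summit.ValiantsHypothesis.ValiantsHypothesis.Theses.TwoAdicLadder.PrecisionLadder := by
  intro hZ hloc hdesc c
  obtain ⟨c', hc'⟩ := hdesc c
  refine ((hZ c').and_eventually hc').mono ?_
  rintro n ⟨⟨k, hk⟩, hn⟩
  refine ⟨k, ?_⟩
  intro R _ _ hPIR hnil hne
  by_contra hle
  obtain ⟨S, _, _, hSloc, hSPIR, hSchar, hSle⟩ := hloc n k R hPIR hnil hne
  exact absurd (hn k S hSloc hSPIR hSchar (hSle.trans (not_lt.mp hle))) (not_le.mpr hk)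

/-- THE SKELETON: the crux, modulo exactly the three registered stubs (compiler-checks that the `Stmt`
copies and the stub statements agree). -/
theorem PrecisionLadder_proof :
    Summit.ValiantsHypothesis.ValiantsHypothesis.Theses.TwoAdicLadder.PrecisionLadder :=
  PrecisionLadder_of stub_ladderZ stub_localise stub_descent

end Summit.ValiantsHypothesis.ValiantsHypothesis.Cruxes.PrecisionLadder.Birth
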